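import Summits.BirchSwinnertonDyer.Rank1Residual.X12.CMSmallPrimePConverse
import Summits.BirchSwinnertonDyer.Rank1Residual.X12.CMNoPrimeTorsion
import Summits.BirchSwinnertonDyer.Rank1Residual.X12.PDescentSelmerCorank
import HarnessLib

/-!
# Burungale–Castella–Skinner–Tian 2022, Corollary B (the mod `p` criterion for analytic rank one of a CM curve) as a THEOREM

HONEST FRAMING (cell `b2b-bsdres`, run/shared/lean/b2b/bsd-rank1-residual/, verbatim in every
file): the goal of the cell is to DELETE the COMBINATION-SHAPED residual classes of the
Birch–Swinnerton-Dyer formula for ALL analytic-rank `≤ 1` elliptic curves over `ℚ` — "full BSD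
formula for every rank `≤ 1` curve in class `C`" assembled STRICTLY from published theorems — so
that the rank-`≤ 1` remainder becomes exactly the CONSTRUCTION-SHAPED classes, which are TYPED
(missing-input `Prop`s), NOT attempted. This is not "finishing BSD". Literature typer seat
`b2b-bsdres-lit-bst` (source: Burungale–Skinner–Tian / Burungale–Castella–Skinner–Tian), gen 2.
Theorems only (no definition, no named fact, no axiom): RANK statements plus the vanishing of
`Ш(E/ℚ)[p^∞]` at ONE prime from a `p`-descent datum; NOT a `p`-part-of-BSD class theorem — class
X12 REMAINS CONSTRUCTION-SHAPED; nothing is booked; no label and no census number moves.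

## The printed statement

A. Burungale, F. Castella, C. Skinner, Y. Tian, *`p^∞`-Selmer groups and rational points on CM
elliptic curves*, Ann. Math. Québec **46** (2022) 325–346 [BurungaleCastellaSkinnerTian2022],
**Corollary B** (p. 327, read on the publisher's PDF `paper:url-22916c5d226d`, PDF p. 3),
verbatim: "Let `(E, K)` be as in Theorem A, and let `p` be a prime of good ordinary reduction for
`E` such that: (i) `E(ℚ)[p] = 0`; (ii) `Sel_p(E/ℚ) ≃ ℤ/pℤ`, where `Sel_p(E/ℚ) ⊂ H¹(ℚ, E[p])` is the
`p`-Selmer group of `E`. Then `ord_{s=1} L(E, s) = 1` and `Ш(E/ℚ)[p^∞] = 0`." Preceded by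
(p. 326): "Note that the 'in particular' clause in Theorem A follows from combining its conclusion
with the fundamental work of Gross–Zagier, Kolyvagin, and Rubin. In turn, this consequence yields
the following mod `p` criterion for analytic rank one." "(E, K) as in Theorem A" = `E/ℚ` with CM
by an order of `K`, the Hecke character of `E` having conductor exactly divisible by `𝔡_K`
(transcribed `DifferentExactlyDividesHeckeConductor W` in the Literature file
`BurungaleCastellaSkinnerTian2022/CMPConverse.lean`, where Theorem A is the named fact
`thmA_analyticRank_eq_one_of_selmerCorank_eq_one` and Cor. B was deliberately NOT vendored as a
binder — D-0026: a corollary is proved, not assumed; this file proves it).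

## Proof

`X12/PDescentSelmerCorank.lean` (this seat): (i) + (ii) ⟹ `corank_{ℤ_p} Sel_{p^∞}(E/ℚ) = 1` for
any elliptic curve over any number field, granting the Cassels–Tate pairing (bsd.S18), and
(i) + (ii) + `rank = 1` ⟹ `Ш[p^∞] = 0`. Over `ℚ` with `(E, K, p)` as in Theorem A: corank `1` ⟹
`ord_{s=1} L(E, s) = 1` (Thm. A, binder `hA`) ⟹ `rank_ℤ E(ℚ) = 1`, `#Ш(E/ℚ) < ∞`
(Gross–Zagier–Kolyvagin–Rubin `rank_eq_analyticRank_of_analyticRank_le_one`, binder `hGZK`) ⟹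
`Ш(E/ℚ)[p^∞] = 0`. Binders: `hA`, `hGZK`, `hCT`; everything else PROVED.

## The `p = 2, 3` and `p ≥ 5` corners of Corollary B (precisely)

* **Hypothesis (i) is AUTOMATIC at every odd good ordinary `p`** (`noPTorsion_of_hasCM_of_goodOrd`):
  a good ordinary prime of a CM curve splits in `K` (Deuring, gen-0 Literature theorem
  `cmSplit_of_hasCM_of_goodOrd`, binder `hDeu`), hence is unramified, hence `E[p]` is irreducible
  and no curve in the `ℚ`-isogeny class has a rational point of order `p` (harvest-1's THEOREM
  `X12.noPTorsion_isogenyClass_of_not_cmRamified`, Mazur 1978 Prop. 6.3 + Deuring; odd `p`). So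
  for `p ≠ 2` Corollary B reads: CM, `𝔡_K ∥ 𝔣_λ`, `p` odd good ordinary, `#Sel_p(E/ℚ) = p` ⟹
  `ord_{s=1} L(E, s) = 1 ∧ Ш(E/ℚ)[p^∞] = 0` — ONE descent number certifies (`corB_of_ne_two`).
* `p ≥ 5`: Burungale–Tian 2020 (tree fact
  `burungaleTian_analyticRank_eq_one_of_selmerCorank_eq_one_of_hasCM`) carries no conductor
  hypothesis and (i) is automatic (`X12.eq_zero_of_nsmul_eq_zero_of_hasCM`, any CM curve, `p ≥ 5`):
  `corB_of_five_le` — CM, `p ≥ 5` good ordinary, `#Sel_p = p` ⟹ the conclusions; NO other hypothesis.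
* `p = 3`: good ordinary at `3` forces `K ∈ {ℚ(√−2), ℚ(√−11)}`; for `K = ℚ(√−11)` (`j ≠ 8000`) the
  conductor hypothesis is automatic too (gen-0 theorem `X12.analyticRank_eq_one_of_goodOrd_three_of_j_ne`):
  `corB_three_of_j_ne` — CM, `j ≠ 8000`, good ordinary at `3`, `#Sel_3 = 3` ⟹ the conclusions;
  `corB_three` keeps the conductor condition only for `j = 8000` (where `v_2(N_E) = 6` is in fact
  never met: PARI certificate j108977, `HOME/b2b-bsdres-lit-bst/BST-BCST.md` §3.3 — one engine,
  indicator-grade, not used here).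
* `p = 2`: good ordinary at `2` forces `K = ℚ(√−7)`, and "incidentally `E(ℚ)[2] ≃ ℤ/2ℤ` for all
  elliptic curves `E/ℚ` with CM by `ℚ(√−7)`" (Rem. D, p. 327): hypothesis (i) FAILS, so Corollary B
  is VACUOUS at `p = 2` (`corB` holds there trivially; nothing is claimed; not formalised).

References: [BurungaleCastellaSkinnerTian2022] Thm. A (p. 326), Cor. B, Rem. D (p. 327);
J. H. Silverman, *AEC* 2nd ed., Thm. X.4.2, X.4.14 [SilvermanAEC2009]; H. Darmon, CBMS 101,
Thm. 3.22 [Darmon2004]; A. Burungale, Y. Tian, Invent. Math. 220 (2020) Thm. 1.2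
[BurungaleTian2019]; S. Lang, *Elliptic Functions*, Ch. 13 §4 Thm. 12 [Lang1987]; B. Mazur,
*Rational isogenies of prime degree*, Invent. Math. 44 (1978) Prop. 6.3 [Mazur1978].
-/

set_option autoImplicit false

noncomputable section

open scoped Classical AddSubgroup

open WeierstrassCurve Literature.NumberTheory.EllipticCurves
  Literature.NumberTheory.EllipticCurves.Rank1Residual
  Literature.NumberTheory.EllipticCurves.BurungaleCastellaSkinnerTian2022

namespace Summit.BirchSwinnertonDyer.Rank1Residual.X12

/-! ## Over `ℚ`: Corollary B -/

section OverQ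

variable (W : WeierstrassCurve ℚ) [W.IsElliptic] [W.IsGloballyMinimal] (p : ℕ) [hp : Fact p.Prime]

omit [W.IsGloballyMinimal] in
/-- **Corollary B below ANY per-pair rank-one `p`-converse** `hconv : corank_{ℤ_p} Sel_{p^∞}(E/ℚ) = 1
⟹ ord_{s=1} L(E, s) = 1`: (i) `E(ℚ)[p] = 0` and (ii) `#Sel_p(E/ℚ) = p` give
`ord_{s=1} L(E, s) = 1`, `rank_ℤ E(ℚ) = 1`, `#Ш(E/ℚ) < ∞` and `Ш(E/ℚ)[p^∞] = 0`. Binders: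
Gross–Zagier–Kolyvagin–Rubin `hGZK` (`rank_eq_analyticRank_of_analyticRank_le_one`, Darmon CBMS 101
Thm. 3.22) and the Cassels–Tate pairing `hCT` (bsd.S18). (`E(ℚ)`'s group law takes a
`DecidableEq ℚ`; the general lemmas carry the classical instance, this binder the computable one —
transported along `Subsingleton.elim`, as in `Typed/SelmerCardCertificate.lean`.)
[cite: BurungaleCastellaSkinnerTian2022, Cor. B (p. 327)] [cite: Darmon2004, Thm. 3.22]
[cite: SilvermanAEC2009, Thm. X.4.14] -/
theorem corB_of_pConverse (hGZK : rank_eq_analyticRank_of_analyticRank_le_one)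
    (hCT : exists_casselsTate_pairing (K := ℚ))
    (hconv : W.selmerCorank p = 1 → W.analyticRank = 1)
    (htors : ∀ P : W.toAffine.Point, p • P = 0 → P = 0)
    (hSel : Nat.card (W.selmerGroup (p : ℤ)) = p) :
    W.analyticRank = 1 ∧ W.mordellWeilRank = 1 ∧ Finite W.sha ∧
      AddCommGroup.primaryComponent W.sha p = ⊥ := by
  have hinst : (instDecidableEqRat : DecidableEq ℚ) = fun a b => Classical.propDecidable (a = b) :=
    Subsingleton.elim _ _
  rw [hinst] at htors
  have hcorank := selmerCorank_eq_one_of_natCard_selmerGroup_eq W p hCT htors hSel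
  have hran : W.analyticRank = 1 := hconv hcorank
  obtain ⟨hrank, hfin⟩ := hGZK W hran.le
  have hrank1 : W.mordellWeilRank = 1 := by rw [hrank, hran]
  exact ⟨hran, hrank1, hfin,
    primaryComponent_sha_eq_bot_of_mordellWeilRank_eq_one W p htors hSel hrank1⟩

/-- **Burungale–Castella–Skinner–Tian 2022, Corollary B** (Ann. Math. Québec 46 (2022), p. 327),
verbatim: "Let `(E, K)` be as in Theorem A, and let `p` be a prime of good ordinary reduction for
`E` such that: (i) `E(ℚ)[p] = 0`; (ii) `Sel_p(E/ℚ) ≃ ℤ/pℤ`, where `Sel_p(E/ℚ) ⊂ H¹(ℚ, E[p])` is the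
`p`-Selmer group of `E`. Then `ord_{s=1} L(E, s) = 1` and `Ш(E/ℚ)[p^∞] = 0`." — as a THEOREM below
Theorem A (`hA`, the Literature fact `thmA_analyticRank_eq_one_of_selmerCorank_eq_one`),
Gross–Zagier–Kolyvagin–Rubin (`hGZK`) and the Cassels–Tate pairing (`hCT`). Transcription: `W/ℚ`
globally minimal (to read `a_p`), `W.HasCM`, the conductor hypothesis of Theorem A
`DifferentExactlyDividesHeckeConductor W`, `p` good (`HasGoodReductionAtPrime`) and ordinary
(`p ∤ a_p`); (i) = no rational point of order `p`; (ii) = `#Sel^(p)(E/ℚ) = p` (a group of prime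
order is `ℤ/pℤ`); conclusions `W.analyticRank = 1`, and also (the "in particular" of Thm. A)
`rank_ℤ E(ℚ) = 1`, `#Ш(E/ℚ) < ∞`, and `Ш(E/ℚ)[p^∞] = ⊥`. At `p = 2` hypothesis (i) is never met
(Rem. D p. 327: `K = ℚ(√−7)` and `E(ℚ)[2] ≃ ℤ/2ℤ`), so the statement is vacuous there.
[cite: BurungaleCastellaSkinnerTian2022, Cor. B (p. 327), Thm. A (p. 326), Rem. D (p. 327)]
[cite: Darmon2004, Thm. 3.22] [cite: SilvermanAEC2009, Thm. X.4.14] -/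
theorem corB (hA : thmA_analyticRank_eq_one_of_selmerCorank_eq_one)
    (hGZK : rank_eq_analyticRank_of_analyticRank_le_one)
    (hCT : exists_casselsTate_pairing (K := ℚ)) (hCM : W.HasCM)
    (hcond : DifferentExactlyDividesHeckeConductor W) (hgood : W.HasGoodReductionAtPrime p)
    (hord : ¬ (p : ℤ) ∣ W.frobeniusTrace p)
    (htors : ∀ P : W.toAffine.Point, p • P = 0 → P = 0)
    (hSel : Nat.card (W.selmerGroup (p : ℤ)) = p) :
    W.analyticRank = 1 ∧ W.mordellWeilRank = 1 ∧ Finite W.sha ∧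
      AddCommGroup.primaryComponent W.sha p = ⊥ :=
  corB_of_pConverse W p hGZK hCT (fun hc ↦ hA W hCM hcond p hgood hord hc) htors hSel

/-- **Hypothesis (i) of Corollary B is automatic at odd good ordinary `p`.** A CM curve `E/ℚ`
with good ORDINARY reduction at an odd prime `p` has no rational point `Q ≠ O` with `p • Q = O`:
`p` splits in the CM field (Deuring, `cmSplit_of_hasCM_of_goodOrd`, binder `hDeu`), so `p ∤ d_K`,
so `E[p]` is irreducible and no curve `ℚ`-isogenous to `E` has rational `p`-torsion (harvest-1's
theorem `noPTorsion_isogenyClass_of_not_cmRamified`). At `p = 2` this FAILS for every such curve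
(Rem. D p. 327: `K = ℚ(√−7)`, `E(ℚ)[2] ≃ ℤ/2ℤ`). [cite: Lang1987, Ch. 13 §4 Thm. 12]
[cite: Mazur1978, §6 Prop. 6.3 (1) (p. 153)] [cite: BurungaleCastellaSkinnerTian2022, Rem. D (p. 327)] -/
theorem noPTorsion_of_hasCM_of_goodOrd
    (hDeu : deuring_not_hasUnitRootAt_of_hasCM_of_not_cmSplit) (hCM : W.HasCM) (hp2 : p ≠ 2)
    (hgood : W.HasGoodReductionAtPrime p) (hord : ¬ (p : ℤ) ∣ W.frobeniusTrace p) :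
    ∀ Q : W.toAffine.Point, p • Q = 0 → Q = 0 :=
  noPTorsion_isogenyClass_of_not_cmRamified W hp2
    (cmSplit_of_hasCM_of_goodOrd hDeu W hCM p hgood hord).1 W (isIsogenous_self W)

/-- **Corollary B at odd `p`, hypothesis (i) discharged**: for `(E, K)` as in Theorem A (CM,
`𝔡_K ∥ 𝔣_λ` transcribed) and `p ≠ 2` of good ordinary reduction, `#Sel_p(E/ℚ) = p` ALONE gives
`ord_{s=1} L(E, s) = 1`, `rank_ℤ E(ℚ) = 1`, `#Ш(E/ℚ) < ∞`, `Ш(E/ℚ)[p^∞] = 0`.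
[cite: BurungaleCastellaSkinnerTian2022, Cor. B (p. 327), Thm. A (p. 326)]
[cite: Lang1987, Ch. 13 §4 Thm. 12] [cite: Darmon2004, Thm. 3.22] -/
theorem corB_of_ne_two (hA : thmA_analyticRank_eq_one_of_selmerCorank_eq_one)
    (hDeu : deuring_not_hasUnitRootAt_of_hasCM_of_not_cmSplit)
    (hGZK : rank_eq_analyticRank_of_analyticRank_le_one)
    (hCT : exists_casselsTate_pairing (K := ℚ)) (hCM : W.HasCM)
    (hcond : DifferentExactlyDividesHeckeConductor W) (hp2 : p ≠ 2)
    (hgood : W.HasGoodReductionAtPrime p) (hord : ¬ (p : ℤ) ∣ W.frobeniusTrace p)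
    (hSel : Nat.card (W.selmerGroup (p : ℤ)) = p) :
    W.analyticRank = 1 ∧ W.mordellWeilRank = 1 ∧ Finite W.sha ∧
      AddCommGroup.primaryComponent W.sha p = ⊥ :=
  corB W p hA hGZK hCT hCM hcond hgood hord (noPTorsion_of_hasCM_of_goodOrd W p hDeu hCM hp2 hgood hord)
    hSel

/-- **Corollary B at `p ≥ 5`: NO conductor hypothesis, NO torsion hypothesis** — there
Burungale–Tian 2020 (Invent. Math. 220, Thm. 1.2; tree fact
`burungaleTian_analyticRank_eq_one_of_selmerCorank_eq_one_of_hasCM`, `hBT`) is the `p`-converse,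
and a CM curve over `ℚ` has no rational `p`-torsion for `p ≥ 5` (harvest-1's theorem
`eq_zero_of_nsmul_eq_zero_of_hasCM`): CM, `p ≥ 5` good ordinary, `#Sel_p(E/ℚ) = p` ⟹
`ord_{s=1} L(E, s) = 1 ∧ rank = 1 ∧ #Ш < ∞ ∧ Ш[p^∞] = 0`. [cite: BurungaleTian2019, Thm. 1.2 (p. 214)]
[cite: BurungaleCastellaSkinnerTian2022, Cor. B (p. 327)] [cite: Darmon2004, Thm. 3.22] -/
theorem corB_of_five_le (hBT : burungaleTian_analyticRank_eq_one_of_selmerCorank_eq_one_of_hasCM)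
    (hGZK : rank_eq_analyticRank_of_analyticRank_le_one)
    (hCT : exists_casselsTate_pairing (K := ℚ)) (hCM : W.HasCM) (h5 : 5 ≤ p)
    (hgood : W.HasGoodReductionAtPrime p) (hord : ¬ (p : ℤ) ∣ W.frobeniusTrace p)
    (hSel : Nat.card (W.selmerGroup (p : ℤ)) = p) :
    W.analyticRank = 1 ∧ W.mordellWeilRank = 1 ∧ Finite W.sha ∧
      AddCommGroup.primaryComponent W.sha p = ⊥ :=
  corB_of_pConverse W p hGZK hCT (fun hc ↦ hBT W hCM p h5 hgood hord hc)
    (fun Q hQ ↦ eq_zero_of_nsmul_eq_zero_of_hasCM W hCM h5 Q hQ) hSel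

omit hp in
/-- **Corollary B at `p = 3` for the `ℚ(√−11)`-curves (`j ≠ 8000`): NO conductor hypothesis, NO
torsion hypothesis** (good ordinary at `3` forces `K ∈ {ℚ(√−2), ℚ(√−11)}` by Deuring `hDeu`; for
`K = ℚ(√−11)` Theorem A's hypothesis is automatic — gen-0 theorem
`analyticRank_eq_one_of_goodOrd_three_of_j_ne` — and (i) is automatic at odd good ordinary `p`):
CM, `j ≠ 8000`, good ordinary at `3`, `#Sel_3(E/ℚ) = 3` ⟹ the conclusions.
[cite: BurungaleCastellaSkinnerTian2022, Cor. B (p. 327), Thm. A (p. 326)]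
[cite: Lang1987, Ch. 13 §4 Thm. 12] [cite: Darmon2004, Thm. 3.22] -/
theorem corB_three_of_j_ne (hA : thmA_analyticRank_eq_one_of_selmerCorank_eq_one)
    (hDeu : deuring_not_hasUnitRootAt_of_hasCM_of_not_cmSplit)
    (hGZK : rank_eq_analyticRank_of_analyticRank_le_one)
    (hCT : exists_casselsTate_pairing (K := ℚ)) (hCM : W.HasCM) (hj : W.j ≠ 8000)
    [Fact (3 : ℕ).Prime] (hgood : W.HasGoodReductionAtPrime 3)
    (hord : ¬ ((3 : ℕ) : ℤ) ∣ W.frobeniusTrace 3)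
    (hSel : Nat.card (W.selmerGroup ((3 : ℕ) : ℤ)) = 3) :
    W.analyticRank = 1 ∧ W.mordellWeilRank = 1 ∧ Finite W.sha ∧
      AddCommGroup.primaryComponent W.sha 3 = ⊥ :=
  corB_of_pConverse W 3 hGZK hCT
    (fun hc ↦ analyticRank_eq_one_of_goodOrd_three_of_j_ne hA hDeu W hCM hj hgood hord hc)
    (noPTorsion_of_hasCM_of_goodOrd W 3 hDeu hCM (by decide) hgood hord) hSel

omit hp in
/-- **Corollary B at every good ordinary `p = 3`, NO torsion hypothesis**, the conductor hypothesis
kept only where it is a condition (`K = ℚ(√−2)`, `j = 8000`: `v_2(N_E) = 6`), via the gen-0 theorem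
`analyticRank_eq_one_of_goodOrd_three`. [cite: BurungaleCastellaSkinnerTian2022, Cor. B (p. 327), Thm. A (p. 326)]
[cite: Lang1987, Ch. 13 §4 Thm. 12] [cite: Darmon2004, Thm. 3.22] -/
theorem corB_three (hA : thmA_analyticRank_eq_one_of_selmerCorank_eq_one)
    (hDeu : deuring_not_hasUnitRootAt_of_hasCM_of_not_cmSplit)
    (hGZK : rank_eq_analyticRank_of_analyticRank_le_one)
    (hCT : exists_casselsTate_pairing (K := ℚ)) (hCM : W.HasCM)
    (hcond8 : cmFieldDiscrOfJ W.j = -8 → DifferentExactlyDividesHeckeConductor W)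
    [Fact (3 : ℕ).Prime] (hgood : W.HasGoodReductionAtPrime 3)
    (hord : ¬ ((3 : ℕ) : ℤ) ∣ W.frobeniusTrace 3)
    (hSel : Nat.card (W.selmerGroup ((3 : ℕ) : ℤ)) = 3) :
    W.analyticRank = 1 ∧ W.mordellWeilRank = 1 ∧ Finite W.sha ∧
      AddCommGroup.primaryComponent W.sha 3 = ⊥ :=
  corB_of_pConverse W 3 hGZK hCT
    (fun hc ↦ analyticRank_eq_one_of_goodOrd_three hA hDeu W hCM hcond8 hgood hord hc)
    (noPTorsion_of_hasCM_of_goodOrd W 3 hDeu hCM (by decide) hgood hord) hSel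

end OverQ

end Summit.BirchSwinnertonDyer.Rank1Residual.X12

end
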